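import Summits.ResolutionOfSingularities.ResolutionOfSingularities.Theorems.FrobeniusClosingSteerDefectCore
import HarnessLib

/-!
# `FrobeniusClosing.Steer` cut at the print frontier

Dimension `3` is Cossart–Piltant; the residue is the dimension-`≥ 4` defect core.

Crux `FrobeniusClosing.Steer` (item `stmt-ResolutionOfSingularities-16345`, shared verbatim with `WildCones`,
`JacobianBudget`, `EscapeRate`): `IsolatedForcedTermination → ∀ p prime, torsor LU over perfect ground fields`.
Line `switching-dichotomy`, lead seat c2 (2026-08-17), reshape r7.

`Theorems/FrobeniusClosingSteerDefectCore.lean` (seat c1, p172387) proved `Steer` EQUIVALENT to its defect core, stated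
for every transcendence degree `n ≥ 3`. The case `n = 3` of that core is KNOWN IN PRINT — local uniformization in
dimension `3`: Cossart–Piltant 2008/2009 (Main Theorem of part II: Artin–Schreier and purely inseparable coverings
`h = X ^ p - g ^ (p - 1) X + f` of a regular local ring of dimension three essentially of finite type over a field
differentially finite over a perfect field, along rank-one valuations with algebraic residue extension — the purely
inseparable case `g = 0` is literally the torsor slice) and Cossart–Piltant 2019 Thm. 1.1 with §4.1 (LU) over every
field; in the tree it is the NAMED FACT `LocalUniformization3 k` (all `k`: `CossartPiltant2019LU3`), unproved there.
This file records the cut: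

* `steer_of_lu3_of_steerDefectCore4` — `Steer` follows from local uniformization in dimension `≤ 3` over perfect
  fields of characteristic `p` TOGETHER WITH the dimension-`≥ 4` defect core (the c1 core with `4 ≤ n`);
* `steerDefectCore4_of_steer` — the dimension-`≥ 4` core is an instance of the crux (no fact needed);
* `steer_iff_steerDefectCore4_of_lu3`, `steer_iff_steerDefectCore4_of_cossartPiltant2019LU3` — hence, GIVEN the
  published dimension-`3` theorem, `Steer` is equivalent to its dimension-`≥ 4` core, verbatim an instance of the
  catalogued barrier `Literature.Barriers.ResolutionOfSingularities.DimensionFourFrontier` (local uniformization in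
  dimension `≥ 4` and positive characteristic).

So the residual of `Steer` splits into a formalization debt (Cossart–Piltant in dimension `3`) and one open problem
(the dimension-`≥ 4` defect core, = the parent crux's F⁹ of stmt-0641 restricted to perfect ground fields and
`n ≥ 4`).
These theorems are CONDITIONAL on the named fact where they say so; nothing here is claimed unconditionally beyond
`steerDefectCore4_of_steer` and the composition itself.
-/

set_option linter.dupNamespace false

open IsLocalRing
open Literature.AlgebraicGeometry.Resolution
open Summit.ResolutionOfSingularities.ResolutionOfSingularities.Theses.FrobeniusClosing
  (Steer IsolatedForcedTermination)
open Summit.ResolutionOfSingularities.ResolutionOfSingularities.Theorems.PfaffLine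

namespace Summit.ResolutionOfSingularities.ResolutionOfSingularities.Theorems.SwitchingDichotomy

/-- **`Steer` from local uniformization in dimension `≤ 3` over perfect fields of characteristic `p` and the
dimension-`≥ 4` defect core** (line `switching-dichotomy`, reshape r7). The composition is c1's
`steer_of_steerDefectCore`; its core hypothesis is discharged at `n = 3` by the dimension-`3` fact through
`LocalUniformization3.relLocalUniformization` and `exists_regularModel_of_relLocalUniformization` (applied to the
model `A₀[t] ⊆ O`), and at `n ≥ 4` by the dimension-`≥ 4` core.
[cite: CossartPiltant2019, Thm. 1.1 with §4.1 (LU)] [cite: CossartPiltant2009, Main Theorem] -/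
theorem steer_of_lu3_of_steerDefectCore4
    (h3 : ∀ p : ℕ, p.Prime → ∀ (k : Type) [Field k] [CharP k p] [PerfectField k], LocalUniformization3.{0} k)
    (hcore4 : IsolatedForcedTermination → ∀ p : ℕ, p.Prime → ∀ n : ℕ, 4 ≤ n →
      (∀ (k K : Type) [Field k] [CharP k p] [PerfectField k] [Field K] [Algebra k K]
        (O : ValuationSubring K) (A₀ : Subalgebra k K) (h₀ : A₀.toSubring ≤ O.toSubring) (t : K),
        Algebra.trdeg k K < (n : Cardinal) →
        (∀ x ∈ O, ∃ f : Polynomial k, f ≠ 0 ∧ Polynomial.aeval x f ∈ O.nonunits) →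
        A₀.FG → t ^ p ∈ A₀ → IsFractionRing (Algebra.adjoin k (insert t (A₀ : Set K))) K →
        IsRegularLocalRing (Localization.AtPrime
          (Ideal.comap (Subring.inclusion h₀) (IsLocalRing.maximalIdeal O))) →
        ∃ (A : Subalgebra k K) (h : A.toSubring ≤ O.toSubring), A₀ ≤ A ∧ t ∈ A ∧ A.FG ∧
          IsFractionRing A K ∧ IsRegularLocalRing (Localization.AtPrime
            (Ideal.comap (Subring.inclusion h) (IsLocalRing.maximalIdeal O)))) →
      ∀ (k K : Type) [Field k] [CharP k p] [PerfectField k] [Field K] [Algebra k K]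
        (O : ValuationSubring K) (A₀ : Subalgebra k K) (h₀ : A₀.toSubring ≤ O.toSubring) (t : K),
        A₀.FG → ∀ (htp : t ^ p ∈ A₀), IsFractionRing (Algebra.adjoin k (insert t (A₀ : Set K))) K →
        IsRegularLocalRing (Localization.AtPrime
          (Ideal.comap (Subring.inclusion h₀) (IsLocalRing.maximalIdeal O))) →
        (Ideal.comap (Subring.inclusion h₀) (IsLocalRing.maximalIdeal O)).IsMaximal →
        (∀ x ∈ O, ∃ f : Polynomial k, f ≠ 0 ∧ Polynomial.aeval x f ∈ O.nonunits) →
        ¬ ringKrullDim (Localization.AtPrime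
          (Ideal.comap (Subring.inclusion h₀) (IsLocalRing.maximalIdeal O))) ≤ 2 →
        ¬ IsAbhyankarPlace O (algebraMap k K).fieldRange ⊤ →
        ¬ (∃ F₀ : Subfield K, (algebraMap k K).fieldRange ≤ F₀ ∧ FGOver (algebraMap k K).fieldRange F₀ ∧
            IsAbhyankarPlace O (algebraMap k K).fieldRange F₀ ∧
            ∀ x w : K, w ≠ 0 → ∃ a ∈ F₀, O.valuation (x - a) < O.valuation w) →
        ¬ (∃ π : K, π ≠ 0 ∧ O.valuation π < 1 ∧
            ∀ z : K, z ≠ 0 → ∃ m : ℤ, O.valuation z = O.valuation π ^ m) →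
        (∀ δ : Derivation ℤ (Localization.AtPrime (Ideal.comap (Subring.inclusion h₀)
            (IsLocalRing.maximalIdeal O))) (Localization.AtPrime (Ideal.comap (Subring.inclusion h₀)
            (IsLocalRing.maximalIdeal O))),
          ¬ IsUnit (δ (algebraMap A₀.toSubring (Localization.AtPrime (Ideal.comap
            (Subring.inclusion h₀) (IsLocalRing.maximalIdeal O))) ⟨t ^ p, htp⟩))) →
        (∀ c : Localization.AtPrime (Ideal.comap (Subring.inclusion h₀) (IsLocalRing.maximalIdeal O)),
          algebraMap A₀.toSubring (Localization.AtPrime (Ideal.comap (Subring.inclusion h₀)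
            (IsLocalRing.maximalIdeal O))) ⟨t ^ p, htp⟩ ≠ c ^ p) →
        Algebra.trdeg k K = (n : Cardinal) →
        ¬ ((∀ R : ℕ → Subring K, R 0 = locAtCentre A₀.toSubring O →
              (∀ i, IsQuadraticTransformAlong O (R i) (R (i + 1))) →
              ∀ x : K, x ∈ O → (∃ y ∈ A₀, ∃ z ∈ A₀, z ≠ 0 ∧ x = y / z) → ∃ i, x ∈ R i) ∧
            (∀ R : ℕ → Subring K, R 0 = locAtCentre A₀.toSubring O →
              (∀ i, IsQuadraticTransformAlong O (R i) (R (i + 1))) →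
              ∀ y : K, (∃ a ∈ A₀, ∃ b ∈ A₀, b ≠ 0 ∧ y = a / b) → y ≠ 0 → O.valuation y < 1 →
                ∃ (i : ℕ) (_ : IsLocalRing (R i)) (z : Fin 1 → R i), IsRsopPart z ∧
                  ∃ n : ℕ, O.valuation ((z 0 : R i) : K) ^ n < O.valuation y) ∧
            ¬ (∀ g : K, (∃ a ∈ A₀, ∃ b ∈ A₀, b ≠ 0 ∧ g = a / b) →
              ∃ w : K, (∃ a ∈ A₀, ∃ b ∈ A₀, b ≠ 0 ∧ w = a / b) ∧
                O.valuation (t ^ p - g ^ p) = O.valuation (w ^ p))) →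
        ∃ (A : Subalgebra k K) (h : A.toSubring ≤ O.toSubring), A₀ ≤ A ∧ t ∈ A ∧ A.FG ∧
          IsFractionRing A K ∧ IsRegularLocalRing (Localization.AtPrime
            (Ideal.comap (Subring.inclusion h) (IsLocalRing.maximalIdeal O)))) :
    Steer := by
  refine steer_of_steerDefectCore ?_
  intro hT p hp n _hn3 ih k K _ _ _ _ _ O A₀ h₀ t hfg htp hfr hreg hmax hzd hdim2 hA hdense hD hδ hpow htr hS
  by_cases h3n : n = 3
  · subst h3n
    have h3' : Algebra.trdeg k K ≤ 3 := by rw [htr]; exact_mod_cast le_refl 3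
    exact exists_regularModel_of_relLocalUniformization O ((h3 p hp k).relLocalUniformization K h3' O)
      A₀ h₀ t hfg (mem_valuationSubring_of_pow_mem O hp.ne_zero (h₀ htp)) hfr
  · exact hcore4 hT p hp n (by omega) ih k K O A₀ h₀ t hfg htp hfr hreg hmax hzd hdim2 hA hdense hD hδ hpow
      htr hS

/-- **The dimension-`≥ 4` defect core is an instance of the crux** (unconditionally: instantiate `Steer` at the
core's data, using the core's own hypothesis `IsolatedForcedTermination`). [folklore] -/
theorem steerDefectCore4_of_steer (h : Steer) :
    IsolatedForcedTermination → ∀ p : ℕ, p.Prime → ∀ n : ℕ, 4 ≤ n →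
      (∀ (k K : Type) [Field k] [CharP k p] [PerfectField k] [Field K] [Algebra k K]
        (O : ValuationSubring K) (A₀ : Subalgebra k K) (h₀ : A₀.toSubring ≤ O.toSubring) (t : K),
        Algebra.trdeg k K < (n : Cardinal) →
        (∀ x ∈ O, ∃ f : Polynomial k, f ≠ 0 ∧ Polynomial.aeval x f ∈ O.nonunits) →
        A₀.FG → t ^ p ∈ A₀ → IsFractionRing (Algebra.adjoin k (insert t (A₀ : Set K))) K →
        IsRegularLocalRing (Localization.AtPrime
          (Ideal.comap (Subring.inclusion h₀) (IsLocalRing.maximalIdeal O))) →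
        ∃ (A : Subalgebra k K) (h : A.toSubring ≤ O.toSubring), A₀ ≤ A ∧ t ∈ A ∧ A.FG ∧
          IsFractionRing A K ∧ IsRegularLocalRing (Localization.AtPrime
            (Ideal.comap (Subring.inclusion h) (IsLocalRing.maximalIdeal O)))) →
      ∀ (k K : Type) [Field k] [CharP k p] [PerfectField k] [Field K] [Algebra k K]
        (O : ValuationSubring K) (A₀ : Subalgebra k K) (h₀ : A₀.toSubring ≤ O.toSubring) (t : K),
        A₀.FG → ∀ (htp : t ^ p ∈ A₀), IsFractionRing (Algebra.adjoin k (insert t (A₀ : Set K))) K →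
        IsRegularLocalRing (Localization.AtPrime
          (Ideal.comap (Subring.inclusion h₀) (IsLocalRing.maximalIdeal O))) →
        (Ideal.comap (Subring.inclusion h₀) (IsLocalRing.maximalIdeal O)).IsMaximal →
        (∀ x ∈ O, ∃ f : Polynomial k, f ≠ 0 ∧ Polynomial.aeval x f ∈ O.nonunits) →
        ¬ ringKrullDim (Localization.AtPrime
          (Ideal.comap (Subring.inclusion h₀) (IsLocalRing.maximalIdeal O))) ≤ 2 →
        ¬ IsAbhyankarPlace O (algebraMap k K).fieldRange ⊤ →
        ¬ (∃ F₀ : Subfield K, (algebraMap k K).fieldRange ≤ F₀ ∧ FGOver (algebraMap k K).fieldRange F₀ ∧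
            IsAbhyankarPlace O (algebraMap k K).fieldRange F₀ ∧
            ∀ x w : K, w ≠ 0 → ∃ a ∈ F₀, O.valuation (x - a) < O.valuation w) →
        ¬ (∃ π : K, π ≠ 0 ∧ O.valuation π < 1 ∧
            ∀ z : K, z ≠ 0 → ∃ m : ℤ, O.valuation z = O.valuation π ^ m) →
        (∀ δ : Derivation ℤ (Localization.AtPrime (Ideal.comap (Subring.inclusion h₀)
            (IsLocalRing.maximalIdeal O))) (Localization.AtPrime (Ideal.comap (Subring.inclusion h₀)
            (IsLocalRing.maximalIdeal O))),
          ¬ IsUnit (δ (algebraMap A₀.toSubring (Localization.AtPrime (Ideal.comap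
            (Subring.inclusion h₀) (IsLocalRing.maximalIdeal O))) ⟨t ^ p, htp⟩))) →
        (∀ c : Localization.AtPrime (Ideal.comap (Subring.inclusion h₀) (IsLocalRing.maximalIdeal O)),
          algebraMap A₀.toSubring (Localization.AtPrime (Ideal.comap (Subring.inclusion h₀)
            (IsLocalRing.maximalIdeal O))) ⟨t ^ p, htp⟩ ≠ c ^ p) →
        Algebra.trdeg k K = (n : Cardinal) →
        ¬ ((∀ R : ℕ → Subring K, R 0 = locAtCentre A₀.toSubring O →
              (∀ i, IsQuadraticTransformAlong O (R i) (R (i + 1))) →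
              ∀ x : K, x ∈ O → (∃ y ∈ A₀, ∃ z ∈ A₀, z ≠ 0 ∧ x = y / z) → ∃ i, x ∈ R i) ∧
            (∀ R : ℕ → Subring K, R 0 = locAtCentre A₀.toSubring O →
              (∀ i, IsQuadraticTransformAlong O (R i) (R (i + 1))) →
              ∀ y : K, (∃ a ∈ A₀, ∃ b ∈ A₀, b ≠ 0 ∧ y = a / b) → y ≠ 0 → O.valuation y < 1 →
                ∃ (i : ℕ) (_ : IsLocalRing (R i)) (z : Fin 1 → R i), IsRsopPart z ∧
                  ∃ n : ℕ, O.valuation ((z 0 : R i) : K) ^ n < O.valuation y) ∧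
            ¬ (∀ g : K, (∃ a ∈ A₀, ∃ b ∈ A₀, b ≠ 0 ∧ g = a / b) →
              ∃ w : K, (∃ a ∈ A₀, ∃ b ∈ A₀, b ≠ 0 ∧ w = a / b) ∧
                O.valuation (t ^ p - g ^ p) = O.valuation (w ^ p))) →
        ∃ (A : Subalgebra k K) (h : A.toSubring ≤ O.toSubring), A₀ ≤ A ∧ t ∈ A ∧ A.FG ∧
          IsFractionRing A K ∧ IsRegularLocalRing (Localization.AtPrime
            (Ideal.comap (Subring.inclusion h) (IsLocalRing.maximalIdeal O))) := by
  intro hT p hp n _ _ k K _ _ _ _ _ O A₀ h₀ t hfg htp hfr hreg _ _ _ _ _ _ _ _ _ _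
  exact h hT p hp k K O A₀ h₀ t hfg htp hfr hreg

/-- **Given local uniformization in dimension `≤ 3` over perfect fields of characteristic `p`, `Steer` is
EQUIVALENT to its dimension-`≥ 4` defect core.** [cite: CossartPiltant2019, Thm. 1.1 with §4.1 (LU)] -/
theorem steer_iff_steerDefectCore4_of_lu3
    (h3 : ∀ p : ℕ, p.Prime → ∀ (k : Type) [Field k] [CharP k p] [PerfectField k], LocalUniformization3.{0} k) :
    Steer ↔
    (IsolatedForcedTermination → ∀ p : ℕ, p.Prime → ∀ n : ℕ, 4 ≤ n →
      (∀ (k K : Type) [Field k] [CharP k p] [PerfectField k] [Field K] [Algebra k K]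
        (O : ValuationSubring K) (A₀ : Subalgebra k K) (h₀ : A₀.toSubring ≤ O.toSubring) (t : K),
        Algebra.trdeg k K < (n : Cardinal) →
        (∀ x ∈ O, ∃ f : Polynomial k, f ≠ 0 ∧ Polynomial.aeval x f ∈ O.nonunits) →
        A₀.FG → t ^ p ∈ A₀ → IsFractionRing (Algebra.adjoin k (insert t (A₀ : Set K))) K →
        IsRegularLocalRing (Localization.AtPrime
          (Ideal.comap (Subring.inclusion h₀) (IsLocalRing.maximalIdeal O))) →
        ∃ (A : Subalgebra k K) (h : A.toSubring ≤ O.toSubring), A₀ ≤ A ∧ t ∈ A ∧ A.FG ∧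
          IsFractionRing A K ∧ IsRegularLocalRing (Localization.AtPrime
            (Ideal.comap (Subring.inclusion h) (IsLocalRing.maximalIdeal O)))) →
      ∀ (k K : Type) [Field k] [CharP k p] [PerfectField k] [Field K] [Algebra k K]
        (O : ValuationSubring K) (A₀ : Subalgebra k K) (h₀ : A₀.toSubring ≤ O.toSubring) (t : K),
        A₀.FG → ∀ (htp : t ^ p ∈ A₀), IsFractionRing (Algebra.adjoin k (insert t (A₀ : Set K))) K →
        IsRegularLocalRing (Localization.AtPrime
          (Ideal.comap (Subring.inclusion h₀) (IsLocalRing.maximalIdeal O))) →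
        (Ideal.comap (Subring.inclusion h₀) (IsLocalRing.maximalIdeal O)).IsMaximal →
        (∀ x ∈ O, ∃ f : Polynomial k, f ≠ 0 ∧ Polynomial.aeval x f ∈ O.nonunits) →
        ¬ ringKrullDim (Localization.AtPrime
          (Ideal.comap (Subring.inclusion h₀) (IsLocalRing.maximalIdeal O))) ≤ 2 →
        ¬ IsAbhyankarPlace O (algebraMap k K).fieldRange ⊤ →
        ¬ (∃ F₀ : Subfield K, (algebraMap k K).fieldRange ≤ F₀ ∧ FGOver (algebraMap k K).fieldRange F₀ ∧
            IsAbhyankarPlace O (algebraMap k K).fieldRange F₀ ∧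
            ∀ x w : K, w ≠ 0 → ∃ a ∈ F₀, O.valuation (x - a) < O.valuation w) →
        ¬ (∃ π : K, π ≠ 0 ∧ O.valuation π < 1 ∧
            ∀ z : K, z ≠ 0 → ∃ m : ℤ, O.valuation z = O.valuation π ^ m) →
        (∀ δ : Derivation ℤ (Localization.AtPrime (Ideal.comap (Subring.inclusion h₀)
            (IsLocalRing.maximalIdeal O))) (Localization.AtPrime (Ideal.comap (Subring.inclusion h₀)
            (IsLocalRing.maximalIdeal O))),
          ¬ IsUnit (δ (algebraMap A₀.toSubring (Localization.AtPrime (Ideal.comap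
            (Subring.inclusion h₀) (IsLocalRing.maximalIdeal O))) ⟨t ^ p, htp⟩))) →
        (∀ c : Localization.AtPrime (Ideal.comap (Subring.inclusion h₀) (IsLocalRing.maximalIdeal O)),
          algebraMap A₀.toSubring (Localization.AtPrime (Ideal.comap (Subring.inclusion h₀)
            (IsLocalRing.maximalIdeal O))) ⟨t ^ p, htp⟩ ≠ c ^ p) →
        Algebra.trdeg k K = (n : Cardinal) →
        ¬ ((∀ R : ℕ → Subring K, R 0 = locAtCentre A₀.toSubring O →
              (∀ i, IsQuadraticTransformAlong O (R i) (R (i + 1))) →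
              ∀ x : K, x ∈ O → (∃ y ∈ A₀, ∃ z ∈ A₀, z ≠ 0 ∧ x = y / z) → ∃ i, x ∈ R i) ∧
            (∀ R : ℕ → Subring K, R 0 = locAtCentre A₀.toSubring O →
              (∀ i, IsQuadraticTransformAlong O (R i) (R (i + 1))) →
              ∀ y : K, (∃ a ∈ A₀, ∃ b ∈ A₀, b ≠ 0 ∧ y = a / b) → y ≠ 0 → O.valuation y < 1 →
                ∃ (i : ℕ) (_ : IsLocalRing (R i)) (z : Fin 1 → R i), IsRsopPart z ∧
                  ∃ n : ℕ, O.valuation ((z 0 : R i) : K) ^ n < O.valuation y) ∧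
            ¬ (∀ g : K, (∃ a ∈ A₀, ∃ b ∈ A₀, b ≠ 0 ∧ g = a / b) →
              ∃ w : K, (∃ a ∈ A₀, ∃ b ∈ A₀, b ≠ 0 ∧ w = a / b) ∧
                O.valuation (t ^ p - g ^ p) = O.valuation (w ^ p))) →
        ∃ (A : Subalgebra k K) (h : A.toSubring ≤ O.toSubring), A₀ ≤ A ∧ t ∈ A ∧ A.FG ∧
          IsFractionRing A K ∧ IsRegularLocalRing (Localization.AtPrime
            (Ideal.comap (Subring.inclusion h) (IsLocalRing.maximalIdeal O)))) :=
  ⟨steerDefectCore4_of_steer, steer_of_lu3_of_steerDefectCore4 h3⟩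

/-- **The same under the tree's named fact `CossartPiltant2019LU3`** (local uniformization in dimension `≤ 3`
over EVERY field; Cossart–Piltant 2019, Thm. 1.1 with §4.1 (LU)): modulo that published theorem, the crux
`Steer` is exactly local uniformization of `α_p`-torsors over perfect fields in dimension `≥ 4` at the listed
residual valuations — an instance of `Literature.Barriers.ResolutionOfSingularities.DimensionFourFrontier`.
[cite: CossartPiltant2019, Thm. 1.1 with §4.1 (LU)] -/
theorem steer_iff_steerDefectCore4_of_cossartPiltant2019LU3 (hCP : CossartPiltant2019LU3.{0}) :
    Steer ↔
    (IsolatedForcedTermination → ∀ p : ℕ, p.Prime → ∀ n : ℕ, 4 ≤ n →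
      (∀ (k K : Type) [Field k] [CharP k p] [PerfectField k] [Field K] [Algebra k K]
        (O : ValuationSubring K) (A₀ : Subalgebra k K) (h₀ : A₀.toSubring ≤ O.toSubring) (t : K),
        Algebra.trdeg k K < (n : Cardinal) →
        (∀ x ∈ O, ∃ f : Polynomial k, f ≠ 0 ∧ Polynomial.aeval x f ∈ O.nonunits) →
        A₀.FG → t ^ p ∈ A₀ → IsFractionRing (Algebra.adjoin k (insert t (A₀ : Set K))) K →
        IsRegularLocalRing (Localization.AtPrime
          (Ideal.comap (Subring.inclusion h₀) (IsLocalRing.maximalIdeal O))) →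
        ∃ (A : Subalgebra k K) (h : A.toSubring ≤ O.toSubring), A₀ ≤ A ∧ t ∈ A ∧ A.FG ∧
          IsFractionRing A K ∧ IsRegularLocalRing (Localization.AtPrime
            (Ideal.comap (Subring.inclusion h) (IsLocalRing.maximalIdeal O)))) →
      ∀ (k K : Type) [Field k] [CharP k p] [PerfectField k] [Field K] [Algebra k K]
        (O : ValuationSubring K) (A₀ : Subalgebra k K) (h₀ : A₀.toSubring ≤ O.toSubring) (t : K),
        A₀.FG → ∀ (htp : t ^ p ∈ A₀), IsFractionRing (Algebra.adjoin k (insert t (A₀ : Set K))) K →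
        IsRegularLocalRing (Localization.AtPrime
          (Ideal.comap (Subring.inclusion h₀) (IsLocalRing.maximalIdeal O))) →
        (Ideal.comap (Subring.inclusion h₀) (IsLocalRing.maximalIdeal O)).IsMaximal →
        (∀ x ∈ O, ∃ f : Polynomial k, f ≠ 0 ∧ Polynomial.aeval x f ∈ O.nonunits) →
        ¬ ringKrullDim (Localization.AtPrime
          (Ideal.comap (Subring.inclusion h₀) (IsLocalRing.maximalIdeal O))) ≤ 2 →
        ¬ IsAbhyankarPlace O (algebraMap k K).fieldRange ⊤ →
        ¬ (∃ F₀ : Subfield K, (algebraMap k K).fieldRange ≤ F₀ ∧ FGOver (algebraMap k K).fieldRange F₀ ∧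
            IsAbhyankarPlace O (algebraMap k K).fieldRange F₀ ∧
            ∀ x w : K, w ≠ 0 → ∃ a ∈ F₀, O.valuation (x - a) < O.valuation w) →
        ¬ (∃ π : K, π ≠ 0 ∧ O.valuation π < 1 ∧
            ∀ z : K, z ≠ 0 → ∃ m : ℤ, O.valuation z = O.valuation π ^ m) →
        (∀ δ : Derivation ℤ (Localization.AtPrime (Ideal.comap (Subring.inclusion h₀)
            (IsLocalRing.maximalIdeal O))) (Localization.AtPrime (Ideal.comap (Subring.inclusion h₀)
            (IsLocalRing.maximalIdeal O))),
          ¬ IsUnit (δ (algebraMap A₀.toSubring (Localization.AtPrime (Ideal.comap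
            (Subring.inclusion h₀) (IsLocalRing.maximalIdeal O))) ⟨t ^ p, htp⟩))) →
        (∀ c : Localization.AtPrime (Ideal.comap (Subring.inclusion h₀) (IsLocalRing.maximalIdeal O)),
          algebraMap A₀.toSubring (Localization.AtPrime (Ideal.comap (Subring.inclusion h₀)
            (IsLocalRing.maximalIdeal O))) ⟨t ^ p, htp⟩ ≠ c ^ p) →
        Algebra.trdeg k K = (n : Cardinal) →
        ¬ ((∀ R : ℕ → Subring K, R 0 = locAtCentre A₀.toSubring O →
              (∀ i, IsQuadraticTransformAlong O (R i) (R (i + 1))) →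
              ∀ x : K, x ∈ O → (∃ y ∈ A₀, ∃ z ∈ A₀, z ≠ 0 ∧ x = y / z) → ∃ i, x ∈ R i) ∧
            (∀ R : ℕ → Subring K, R 0 = locAtCentre A₀.toSubring O →
              (∀ i, IsQuadraticTransformAlong O (R i) (R (i + 1))) →
              ∀ y : K, (∃ a ∈ A₀, ∃ b ∈ A₀, b ≠ 0 ∧ y = a / b) → y ≠ 0 → O.valuation y < 1 →
                ∃ (i : ℕ) (_ : IsLocalRing (R i)) (z : Fin 1 → R i), IsRsopPart z ∧
                  ∃ n : ℕ, O.valuation ((z 0 : R i) : K) ^ n < O.valuation y) ∧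
            ¬ (∀ g : K, (∃ a ∈ A₀, ∃ b ∈ A₀, b ≠ 0 ∧ g = a / b) →
              ∃ w : K, (∃ a ∈ A₀, ∃ b ∈ A₀, b ≠ 0 ∧ w = a / b) ∧
                O.valuation (t ^ p - g ^ p) = O.valuation (w ^ p))) →
        ∃ (A : Subalgebra k K) (h : A.toSubring ≤ O.toSubring), A₀ ≤ A ∧ t ∈ A ∧ A.FG ∧
          IsFractionRing A K ∧ IsRegularLocalRing (Localization.AtPrime
            (Ideal.comap (Subring.inclusion h) (IsLocalRing.maximalIdeal O)))) :=
  steer_iff_steerDefectCore4_of_lu3 fun _ _ k _ _ _ => hCP k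

end Summit.ResolutionOfSingularities.ResolutionOfSingularities.Theorems.SwitchingDichotomy
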